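import Summits.AtomisticToContinuum.BoseEinsteinCondensation.Theses.BECThomsonPrinciple
import Summits.AtomisticToContinuum.BoseEinsteinCondensation.Theorems.BECInsertionCorrectorStaticResponseBoundFreeSquare
import Summits.AtomisticToContinuum.BoseEinsteinCondensation.Theorems.BECInsertionCorrectorStaticResponseBoundInfraredWindow
import Summits.AtomisticToContinuum.BoseEinsteinCondensation.Theorems.BECInsertionCorrectorStaticResponseBoundDensityResponseOfSRB
import Summits.AtomisticToContinuum.BoseEinsteinCondensation.Theorems.DensityResponse.Negative.StiffnessSwitch
import Literature.MathematicalPhysics.QuantumManyBody.PeriodicBoseGasKineticMultiplierProofs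
import Literature.MathematicalPhysics.QuantumManyBody.BoseGasThermodynamicLimitRuelle
import HarnessLib

/-!
# `DensityResponse` (stmt-9481) IS the infrared half of `StaticResponseBound` (stmt-12057) — kernel certificate

Helper (calibration) file for the crux `BECThomsonPrinciple.DensityResponse` (item stmt-AtomisticToContinuum-9481,
line `force-balance-constitutive`, lead c1; supports, does not close, the item).

`densityResponse_iff_infraredHalf`: the crux BY NAME is EQUIVALENT to the INFRARED HALF of the sibling crux
`BECInsertionCorrector.StaticResponseBound` (item stmt-AtomisticToContinuum-12057) — verbatim the first hypothesis of the
landed composition `UvThomsonForceWave.staticResponseBound_of_halves` (`…StaticResponseBoundUvComposition.lean`) and the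
registered stub `stub_infraredHalf` of that crux's line `uv-thomson-force-wave` (= `StaticResponseBoundPhonon` of line
`stable-fraction-square-completion`):

  `∀ v admissible ∀ M₀ > 0 ∃ ρ₀ > 0 ∃ C > 0 ∀ ρ ∈ (0, ρ₀) ∀ N > 0 ∀ k ≠ 0 with |p|² ≤ M₀² ρ a ∀ t ∀ finite-energy Ψ:`
  `E₀(N, L) − C t² N / max(ρa, |p|²) ≤ E_v(Ψ) + t ⟨∑ⱼ cos(p·xⱼ)⟩_Ψ`,  `L = (N/ρ)^{1/3}`, `p = 2πk/L`, `a = a(v)`.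

* `densityResponse_of_infraredHalf` (⟸, window surgery): the phonon window `|p|² ≤ M₀²ρa` with `M₀ = M√(3/a)` covers the
  crux's window `k∞ ≤ M√ρ` when `a(v) > 0` (`|p|² ≤ 3k∞²`); `a(v) = 0` is the landed free chord `holdsWith_zero_of_ae`
  (`v = 0` a.e. by `LSSY2005_zeroScatteringLength_holds`); `t = ∓2s`, `C ↦ 8C`, `ρ₀ ↦ ρ₀/2`, `N₀ = 1`.
* `infraredHalf_of_densityResponse` (⟹): at `a(v) = 0` the phonon window is empty (`|p|² > 0`); at `a(v) > 0` take the crux's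
  window parameter `M = M₀√a` (`k∞² ≤ |p|² ≤ M₀²ρa = M²ρ`), `s = |t|/2`, the same `C` (`max(ρa,|p|²) ≤ 4(k∞² + ρa)`), and
  shrink `ρ₀` below `(4π²)³/(M⁶(N₀+1)²)`: the window and `L³ = N/ρ` force `(4π²)³ ≤ M⁶ρN²`, hence `N > N₀` — the crux's
  threshold `N₀` is decoration (Disproof §14), so no few-body input is needed.

Consequence: stmt-9481 is stmt-12057 minus its ultraviolet half — every infrared artefact of 12057 applies to 9481 verbatim and ONE
conjecture item (the text above) conditions both cruxes.  No new definitions; the infrared text is written inline.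
-/

noncomputable section

namespace Summit.AtomisticToContinuum.BoseEinsteinCondensation.Cruxes.DensityResponse.InfraredEquiv

open MeasureTheory
open scoped ENNReal BigOperators
open Literature.MathematicalPhysics.QuantumManyBody.BoseGas
open Summit.AtomisticToContinuum.BoseEinsteinCondensation.Theses
open Summit.AtomisticToContinuum.BoseEinsteinCondensation.Theorems.StaticResponseBound.Negative
  (psq cosMean Ineq psq_nonneg sideLength_pos)
open Summit.AtomisticToContinuum.BoseEinsteinCondensation.Theorems.DensityResponse.Negative
  (HoldsWith holdsWith_zero_of_ae)
open Summit.AtomisticToContinuum.BoseEinsteinCondensation.Cruxes.StaticResponseBound.UvThomsonForceWave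
  (freeSq_psq_pos sq_div_le_psq)
open Summit.AtomisticToContinuum.BoseEinsteinCondensation.Cruxes.StaticResponseBound.StableFractionSquareCompletion
  (dr_sideLength_density dr_supNorm_sq_le_psq dr_integral_two_cos)

/-! ### Arithmetic of the two windows -/

/-- `|p|² ≤ 3 (2π‖n‖_∞/L)²` (Euclidean norm below `√3` times the sup norm). [folklore] -/
theorem ir_psq_le_three_kinf_sq (L : ℝ) (n : Fin 3 → ℤ) :
    psq L n ≤ 3 * (2 * Real.pi * ‖(fun j => (n j : ℝ))‖ / L) ^ 2 := by
  have hcoord : ∀ i, (n i : ℝ) ^ 2 ≤ ‖(fun j => (n j : ℝ))‖ ^ 2 := fun i => by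
    rw [← sq_abs, ← Real.norm_eq_abs]
    exact pow_le_pow_left₀ (norm_nonneg _) (norm_le_pi_norm (fun j => (n j : ℝ)) i) 2
  have hsum : ∑ i, (n i : ℝ) ^ 2 ≤ 3 * ‖(fun j => (n j : ℝ))‖ ^ 2 := by
    calc ∑ i, (n i : ℝ) ^ 2 ≤ ∑ _i : Fin 3, ‖(fun j => (n j : ℝ))‖ ^ 2 :=
          Finset.sum_le_sum fun i _ => hcoord i
      _ = 3 * ‖(fun j => (n j : ℝ))‖ ^ 2 := by simp
  unfold psq
  calc (2 * Real.pi / L) ^ 2 * ∑ i, (n i : ℝ) ^ 2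
      ≤ (2 * Real.pi / L) ^ 2 * (3 * ‖(fun j => (n j : ℝ))‖ ^ 2) :=
        mul_le_mul_of_nonneg_left hsum (sq_nonneg _)
    _ = 3 * (2 * Real.pi * ‖(fun j => (n j : ℝ))‖ / L) ^ 2 := by ring

/-! ### ⟸ : the infrared half implies the crux (window surgery) -/

/-- **The infrared half of `StaticResponseBound` implies `DensityResponse`.**  With `M₀ = M√(3/a)` the phonon window
`|p|² ≤ M₀²ρa` covers the crux's window `k∞ ≤ M√ρ` when `a(v) > 0`; `a(v) = 0` is the free chord.  Constants:
`ρ₀ ↦ ρ₀/2`, `C ↦ 8C`, `N₀ = 1`, coupling `t = ∓2s`. [folklore] -/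
theorem densityResponse_of_infraredHalf
    (hP : ∀ v : ℝ → ℝ≥0∞, IsRepulsiveFiniteRange v → ∀ M₀ : ℝ, 0 < M₀ →
      ∃ ρ₀ : ℝ, 0 < ρ₀ ∧ ∃ C : ℝ, 0 < C ∧
        ∀ ρ : ℝ, 0 < ρ → ρ < ρ₀ → ∀ N : ℕ, 0 < N → ∀ k : Fin 3 → ℤ, k ≠ 0 →
          psq (sideLength ρ N) k ≤ M₀ ^ 2 * (ρ * (scatteringLength v).toReal) →
          ∀ t : ℝ, ∀ Ψ : PeriodicTrialState N (sideLength ρ N), periodicEnergy v Ψ ≠ ⊤ →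
            Ineq v C ρ N k t Ψ) :
    BECThomsonPrinciple.DensityResponse := by
  intro v hv M hM
  obtain ⟨R₀, hR₀⟩ := hv.2
  by_cases ha : scatteringLength v = 0
  · -- free chord
    have hv0 : ∀ᵐ x : Space, v ‖x‖ = 0 := LSSY2005_zeroScatteringLength_holds v R₀ hv.1 hR₀ ha
    refine ⟨1, 4, one_pos, by norm_num, 0, ?_⟩
    have h := holdsWith_zero_of_ae hv.1 hv0 M 1 0
    rw [ha, ENNReal.toReal_zero]
    exact h
  -- interacting case: a(v) > 0
  have hapos : 0 < (scatteringLength v).toReal :=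
    ENNReal.toReal_pos ha (scatteringLength_ne_top_of_finiteRange hR₀)
  set a : ℝ := (scatteringLength v).toReal with hadef
  set M₀ : ℝ := M * Real.sqrt (3 / a) with hM₀def
  have hM₀ : 0 < M₀ := mul_pos hM (Real.sqrt_pos.2 (div_pos (by norm_num) hapos))
  have hM₀sq : M₀ ^ 2 * a = 3 * M ^ 2 := by
    rw [hM₀def, mul_pow, Real.sq_sqrt (div_pos (by norm_num) hapos).le]
    field_simp
  obtain ⟨ρ₀, hρ₀, C, hC, h⟩ := hP v hv M₀ hM₀
  refine ⟨ρ₀ / 2, 8 * C, by positivity, by positivity, 1, ?_⟩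
  intro N hN L hL hNL n hn hwin s hs Φ
  by_cases hE : periodicEnergy v Φ = ⊤
  · simp [hE]
  set ρ : ℝ := (N : ℝ) / L ^ 3 with hρdef
  have hNpos : (0 : ℝ) < N := Nat.cast_pos.2 hN
  have hL3 : 0 < L ^ 3 := pow_pos hL 3
  have hρpos : 0 < ρ := div_pos hNpos hL3
  have hρlt : ρ < ρ₀ := by
    have : ρ ≤ ρ₀ / 2 := by rw [hρdef, div_le_iff₀ hL3]; exact hNL
    linarith
  have hL' : sideLength ρ N = L := dr_sideLength_density hN hL
  -- the window: `k∞² ≤ M² ρ` ⟹ `|p|² ≤ 3M²ρ = M₀² ρ a`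
  set q : ℝ := (2 * Real.pi * ‖(fun j => (n j : ℝ))‖ / L) ^ 2 with hqdef
  have hk0 : 0 ≤ 2 * Real.pi * ‖(fun j => (n j : ℝ))‖ / L := by positivity
  have hq_le : q ≤ M ^ 2 * ρ := by
    have h1 : (2 * Real.pi * ‖(fun j => (n j : ℝ))‖ / L) ^ 2 ≤ (M * Real.sqrt (N / L ^ 3)) ^ 2 :=
      pow_le_pow_left₀ hk0 hwin 2
    rw [mul_pow, Real.sq_sqrt hρpos.le] at h1
    exact h1
  have hwin' : psq (sideLength ρ N) n ≤ M₀ ^ 2 * (ρ * (scatteringLength v).toReal) := by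
    rw [hL']
    calc psq L n ≤ 3 * q := ir_psq_le_three_kinf_sq L n
      _ ≤ 3 * (M ^ 2 * ρ) := by nlinarith
      _ = M₀ ^ 2 * (ρ * a) := by
          rw [show M₀ ^ 2 * (ρ * a) = (M₀ ^ 2 * a) * ρ by ring, hM₀sq]; ring
  have key := h ρ hρpos hρlt N hN n hn hwin'
  unfold Ineq cosMean at key
  rw [hL'] at key
  set I : ℝ := ∫ X in cellN N L, (∑ i, Real.cos (2 * Real.pi / L * ∑ j, (n j : ℝ) * X i j)) *
    ‖Φ.ψ X‖ ^ 2 with hIdef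
  have hsrc : (∫ X in cellN N L, (∑ i, 2 * Real.cos (2 * Real.pi / L * ∑ j, (n j : ℝ) * X i j)) *
      ‖Φ.ψ X‖ ^ 2) = 2 * I := by
    rw [hIdef, ← integral_const_mul]
    congr 1; ext X
    rw [← Finset.mul_sum]; ring
  set t : ℝ := if 0 ≤ I then -(2 * s) else 2 * s with htdef
  have htI : t * I = -(2 * s * |I|) := by
    rw [htdef]; split_ifs with hI
    · rw [abs_of_nonneg hI]; ring
    · rw [abs_of_neg (lt_of_not_ge hI)]; ring
  have ht2 : t ^ 2 = 4 * s ^ 2 := by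
    rw [htdef]; split_ifs <;> ring
  have key' : (periodicGroundStateEnergy v N L).toReal - C * t ^ 2 * N /
      max (ρ * (scatteringLength v).toReal) (psq L n) ≤ (periodicEnergy v Φ).toReal + t * I :=
    key t Φ hE
  rw [htI, ht2] at key'
  have ha0 : 0 ≤ a := hapos.le
  have hq : 0 < q := by
    have := freeSq_psq_pos hL hn
    have h3 := ir_psq_le_three_kinf_sq L n
    rw [← hqdef] at h3
    linarith
  have hden : 0 < q + ρ * a := by nlinarith [mul_nonneg hρpos.le ha0]
  have hmax : (q + ρ * a) / 2 ≤ max (ρ * a) (psq L n) := by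
    have h1 : q ≤ psq L n := dr_supNorm_sq_le_psq L n
    have h2 := le_max_right (ρ * a) (psq L n)
    have h3 := le_max_left (ρ * a) (psq L n)
    linarith
  have hmaxpos : 0 < max (ρ * a) (psq L n) := by linarith
  have hreal : (periodicGroundStateEnergy v N L).toReal + 2 * s * |I| ≤
      (periodicEnergy v Φ).toReal + 8 * C * s ^ 2 * N / (q + ρ * a) := by
    have hfrac : C * (4 * s ^ 2) * N / max (ρ * a) (psq L n)
        ≤ 8 * C * s ^ 2 * N / (q + ρ * a) := by
      rw [div_le_div_iff₀ hmaxpos hden]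
      have hnum : 0 ≤ C * (4 * s ^ 2) * N := by positivity
      nlinarith [mul_le_mul_of_nonneg_left hmax hnum]
    have : max (ρ * (scatteringLength v).toReal) (psq L n) = max (ρ * a) (psq L n) := rfl
    rw [this] at key'
    linarith
  have hE0 : periodicGroundStateEnergy v N L ≠ ⊤ :=
    ne_top_of_le_ne_top hE (periodicGroundStateEnergy_le v Φ)
  have hlhs : periodicGroundStateEnergy v N L +
      ENNReal.ofReal (s * |∫ X in cellN N L, (∑ i, 2 * Real.cos (2 * Real.pi / L *
        ∑ j, (n j : ℝ) * X i j)) * ‖Φ.ψ X‖ ^ 2|) =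
      ENNReal.ofReal ((periodicGroundStateEnergy v N L).toReal + 2 * s * |I|) := by
    rw [hsrc, abs_mul, abs_of_pos (by norm_num : (0:ℝ) < 2), ← mul_assoc, mul_comm s 2,
      ENNReal.ofReal_add ENNReal.toReal_nonneg (by positivity), ENNReal.ofReal_toReal hE0]
  rw [hlhs]
  have hρa : (N : ℝ) / L ^ 3 * (scatteringLength v).toReal = ρ * a := rfl
  rw [hρa]
  calc ENNReal.ofReal ((periodicGroundStateEnergy v N L).toReal + 2 * s * |I|)
      ≤ ENNReal.ofReal ((periodicEnergy v Φ).toReal + 8 * C * s ^ 2 * N / (q + ρ * a)) :=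
        ENNReal.ofReal_le_ofReal hreal
    _ ≤ ENNReal.ofReal ((periodicEnergy v Φ).toReal) +
          ENNReal.ofReal (8 * C * s ^ 2 * N / (q + ρ * a)) := ENNReal.ofReal_add_le
    _ = periodicEnergy v Φ + ENNReal.ofReal (8 * C * s ^ 2 * N / (q + ρ * a)) := by
        rw [ENNReal.ofReal_toReal hE]

/-! ### ⟹ : the crux implies the infrared half -/

/-- Unpacking a chord inequality in `ℝ≥0∞` with finite energies into reals. [folklore] -/
theorem ir_real_of_chord {E₀ E : ℝ≥0∞} {X Y : ℝ} (hX : 0 ≤ X) (hY : 0 ≤ Y) (hE₀ : E₀ ≠ ⊤) (hE : E ≠ ⊤)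
    (h : E₀ + ENNReal.ofReal X ≤ E + ENNReal.ofReal Y) : E₀.toReal + X ≤ E.toReal + Y := by
  have hmono := ENNReal.toReal_mono (ENNReal.add_ne_top.2 ⟨hE, ENNReal.ofReal_ne_top⟩) h
  rwa [ENNReal.toReal_add hE₀ ENNReal.ofReal_ne_top, ENNReal.toReal_add hE ENNReal.ofReal_ne_top,
    ENNReal.toReal_ofReal hX, ENNReal.toReal_ofReal hY] at hmono

/-- **Threshold removal** (Disproof §14, re-derived): on the box `L = (N/ρ)^{1/3}` a non-empty window `(2π/L)² ≤ M²ρ`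
forces `(4π²)³ ≤ M⁶ ρ N²`; hence `ρ < (4π²)³/(M⁶(N₀+1)²)` gives `N₀ ≤ N`. [folklore] -/
theorem ir_threshold {M ρ : ℝ} (hM : 0 < M) (hρ : 0 < ρ) {N N₀ : ℕ} (hN : 0 < N)
    (hwin : (2 * Real.pi / sideLength ρ N) ^ 2 ≤ M ^ 2 * ρ)
    (hρB : ρ < (4 * Real.pi ^ 2) ^ 3 / (M ^ 6 * ((N₀ : ℝ) + 1) ^ 2)) : N₀ ≤ N := by
  have hL : 0 < sideLength ρ N := sideLength_pos hρ hN
  have hL3 : sideLength ρ N ^ 3 = N / ρ := sideLength_pow_three hρ N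
  have hNpos : (0 : ℝ) < N := Nat.cast_pos.2 hN
  -- `4π² ≤ M² ρ L²`
  have h1 : 4 * Real.pi ^ 2 ≤ M ^ 2 * ρ * sideLength ρ N ^ 2 := by
    have hL2 : 0 < sideLength ρ N ^ 2 := pow_pos hL 2
    have heq : (2 * Real.pi / sideLength ρ N) ^ 2 = 4 * Real.pi ^ 2 / sideLength ρ N ^ 2 := by
      rw [div_pow]; ring
    rw [heq, div_le_iff₀ hL2] at hwin
    linarith
  -- cube it: `(4π²)³ ≤ M⁶ ρ³ L⁶ = M⁶ ρ N²`
  have h2 : (4 * Real.pi ^ 2) ^ 3 ≤ (M ^ 2 * ρ * sideLength ρ N ^ 2) ^ 3 :=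
    pow_le_pow_left₀ (by positivity) h1 3
  have h3 : (M ^ 2 * ρ * sideLength ρ N ^ 2) ^ 3 = M ^ 6 * ρ * (N : ℝ) ^ 2 := by
    have hre : (M ^ 2 * ρ * sideLength ρ N ^ 2) ^ 3 = M ^ 6 * ρ ^ 3 * (sideLength ρ N ^ 3) ^ 2 := by ring
    rw [hre, hL3, div_pow]
    field_simp
  rw [h3] at h2
  -- with `ρ < (4π²)³/(M⁶(N₀+1)²)`: `(N₀+1)² < N²`
  have hMN : 0 < M ^ 6 * (N : ℝ) ^ 2 := by positivity
  have hden : 0 < M ^ 6 * ((N₀ : ℝ) + 1) ^ 2 := by positivity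
  have h4 : (4 * Real.pi ^ 2) ^ 3 < M ^ 6 * (N : ℝ) ^ 2 * ((4 * Real.pi ^ 2) ^ 3 / (M ^ 6 * ((N₀ : ℝ) + 1) ^ 2)) := by
    calc (4 * Real.pi ^ 2) ^ 3 ≤ M ^ 6 * ρ * (N : ℝ) ^ 2 := h2
      _ = M ^ 6 * (N : ℝ) ^ 2 * ρ := by ring
      _ < M ^ 6 * (N : ℝ) ^ 2 * ((4 * Real.pi ^ 2) ^ 3 / (M ^ 6 * ((N₀ : ℝ) + 1) ^ 2)) :=
          mul_lt_mul_of_pos_left hρB hMN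
  have h4π : 0 < (4 * Real.pi ^ 2) ^ 3 := by positivity
  have h5 : ((N₀ : ℝ) + 1) ^ 2 < (N : ℝ) ^ 2 := by
    rw [mul_div_assoc', lt_div_iff₀ hden] at h4
    -- `h4 : (4π²)³ (M⁶ (N₀+1)²) < M⁶ N² (4π²)³`
    have h6 : M ^ 6 * (((N₀ : ℝ) + 1) ^ 2) < M ^ 6 * (N : ℝ) ^ 2 := by nlinarith
    exact lt_of_mul_lt_mul_left h6 (by positivity)
  have h7 : (N₀ : ℝ) + 1 < N := lt_of_pow_lt_pow_left₀ 2 hNpos.le h5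
  have h8 : (N₀ : ℝ) < N := by linarith
  exact_mod_cast h8.le

/-- **`DensityResponse` implies the infrared half of `StaticResponseBound`.**  At `a(v) = 0` the phonon window is
empty; at `a(v) > 0` use the crux with window parameter `M = M₀√a`, coupling `s = |t|/2`, the same constant `C`
(`max(ρa,|p|²) ≤ 4(k∞² + ρa)`), and `ρ₀` shrunk below `(4π²)³/(M⁶(N₀+1)²)` so that every admissible datum has `N > N₀`
(`ir_threshold`: the crux's threshold `N₀` is decoration). [folklore] -/
theorem infraredHalf_of_densityResponse (hD : BECThomsonPrinciple.DensityResponse) :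
    ∀ v : ℝ → ℝ≥0∞, IsRepulsiveFiniteRange v → ∀ M₀ : ℝ, 0 < M₀ →
      ∃ ρ₀ : ℝ, 0 < ρ₀ ∧ ∃ C : ℝ, 0 < C ∧
        ∀ ρ : ℝ, 0 < ρ → ρ < ρ₀ → ∀ N : ℕ, 0 < N → ∀ k : Fin 3 → ℤ, k ≠ 0 →
          psq (sideLength ρ N) k ≤ M₀ ^ 2 * (ρ * (scatteringLength v).toReal) →
          ∀ t : ℝ, ∀ Ψ : PeriodicTrialState N (sideLength ρ N), periodicEnergy v Ψ ≠ ⊤ →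
            Ineq v C ρ N k t Ψ := by
  intro v hv M₀ hM₀
  obtain ⟨a, hadef⟩ : ∃ a : ℝ, (scatteringLength v).toReal = a := ⟨_, rfl⟩
  have ha0 : 0 ≤ a := hadef ▸ ENNReal.toReal_nonneg
  rcases ha0.eq_or_lt with ha | hapos
  · -- `a(v) = 0`: the phonon window `|p|² ≤ M₀² ρ · 0` is empty
    refine ⟨1, one_pos, 1, one_pos, ?_⟩
    intro ρ hρ _ N hN k hk hwin t Ψ _
    exfalso
    have hpsq : 0 < psq (sideLength ρ N) k := freeSq_psq_pos (sideLength_pos hρ hN) hk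
    rw [hadef, ← ha, mul_zero, mul_zero] at hwin
    linarith
  -- `a(v) > 0`: the crux at window parameter `M = M₀ √a`
  obtain ⟨M, hMdef⟩ : ∃ M : ℝ, M = M₀ * Real.sqrt a := ⟨_, rfl⟩
  have hM : 0 < M := hMdef ▸ mul_pos hM₀ (Real.sqrt_pos.2 hapos)
  have hMsq : M ^ 2 = M₀ ^ 2 * a := by rw [hMdef, mul_pow, Real.sq_sqrt hapos.le]
  obtain ⟨ρ₀, C, hρ₀, hC, N₀, h⟩ := hD v hv M hM
  have hB : 0 < (4 * Real.pi ^ 2) ^ 3 / (M ^ 6 * ((N₀ : ℝ) + 1) ^ 2) := by positivity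
  refine ⟨min ρ₀ ((4 * Real.pi ^ 2) ^ 3 / (M ^ 6 * ((N₀ : ℝ) + 1) ^ 2)), lt_min hρ₀ hB, C, hC, ?_⟩
  intro ρ hρ hρ₁ N hN k hk hwin t Ψ hΨ
  have hρρ₀ : ρ < ρ₀ := hρ₁.trans_le (min_le_left _ _)
  have hρB : ρ < (4 * Real.pi ^ 2) ^ 3 / (M ^ 6 * ((N₀ : ℝ) + 1) ^ 2) := hρ₁.trans_le (min_le_right _ _)
  have hL : 0 < sideLength ρ N := sideLength_pos hρ hN
  have hL3 : sideLength ρ N ^ 3 = N / ρ := sideLength_pow_three hρ N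
  have hNpos : (0 : ℝ) < N := Nat.cast_pos.2 hN
  have hρL : (N : ℝ) / sideLength ρ N ^ 3 = ρ := by
    rw [hL3]; field_simp
  -- diluteness `N ≤ ρ₀ L³`
  have hdil : (N : ℝ) ≤ ρ₀ * sideLength ρ N ^ 3 := by
    rw [hL3]
    have hNρ : (N : ℝ) = ρ * (N / ρ) := by field_simp
    calc (N : ℝ) = ρ * (N / ρ) := hNρ
      _ ≤ ρ₀ * (N / ρ) := mul_le_mul_of_nonneg_right hρρ₀.le (by positivity)
  -- the two momentum squares
  obtain ⟨kinf, hkinfdef⟩ : ∃ q : ℝ, q = 2 * Real.pi * ‖(fun j => (k j : ℝ))‖ / sideLength ρ N := ⟨_, rfl⟩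
  have hk0 : 0 ≤ kinf := by rw [hkinfdef]; positivity
  have hkinf_psq : kinf ^ 2 ≤ psq (sideLength ρ N) k := hkinfdef ▸ dr_supNorm_sq_le_psq _ k
  have hpsq3 : psq (sideLength ρ N) k ≤ 3 * kinf ^ 2 := hkinfdef ▸ ir_psq_le_three_kinf_sq _ k
  have hpsqpos : 0 < psq (sideLength ρ N) k := freeSq_psq_pos hL hk
  have hwinM : psq (sideLength ρ N) k ≤ M ^ 2 * ρ := hwin.trans_eq (by rw [hadef, hMsq]; ring)
  have hkinf_sq : kinf ^ 2 ≤ M ^ 2 * ρ := hkinf_psq.trans hwinM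
  -- the crux's window `k∞ ≤ M √(N/L³)`
  have hwin' : 2 * Real.pi * ‖(fun j => (k j : ℝ))‖ / sideLength ρ N ≤ M * Real.sqrt (N / sideLength ρ N ^ 3) := by
    rw [← hkinfdef, hρL]
    have h1 : kinf = Real.sqrt (kinf ^ 2) := (Real.sqrt_sq hk0).symm
    have h2 : M * Real.sqrt ρ = Real.sqrt (M ^ 2 * ρ) := by
      rw [Real.sqrt_mul (sq_nonneg M), Real.sqrt_sq hM.le]
    rw [h1, h2]
    exact Real.sqrt_le_sqrt hkinf_sq
  -- the threshold `N₀ ≤ N`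
  have hNN₀ : N₀ ≤ N := ir_threshold hM hρ hN ((sq_div_le_psq _ hk).trans hwinM) hρB
  -- the crux at `s = |t|/2`, unpacked to reals
  have hs : 0 ≤ |t| / 2 := by positivity
  have key := h N hNN₀ (sideLength ρ N) hL hdil k hk hwin' (|t| / 2) hs Ψ
  have hE0 : periodicGroundStateEnergy v N (sideLength ρ N) ≠ ⊤ :=
    ne_top_of_le_ne_top hΨ (periodicGroundStateEnergy_le v Ψ)
  have hreal := ir_real_of_chord (by positivity) (by positivity) hE0 hΨ key
  rw [dr_integral_two_cos, hρL, hadef, ← hkinfdef] at hreal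
  -- `hreal : E₀.toReal + |t|/2 · |2⟨∑cos⟩| ≤ E.toReal + C (|t|/2)² N/(k∞² + ρa)`
  have habs : |t| / 2 * |2 * cosMean (sideLength ρ N) k Ψ| = |t| * |cosMean (sideLength ρ N) k Ψ| := by
    rw [abs_mul, abs_of_pos (by norm_num : (0:ℝ) < 2)]; ring
  rw [habs] at hreal
  -- compare denominators: `max(ρa, |p|²) ≤ 4 (k∞² + ρa)`
  have hρa : 0 ≤ ρ * a := mul_nonneg hρ.le hapos.le
  have hden : 0 < kinf ^ 2 + ρ * a := by nlinarith
  have hmaxpos : 0 < max (ρ * a) (psq (sideLength ρ N) k) := lt_max_of_lt_right hpsqpos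
  have hmaxle : max (ρ * a) (psq (sideLength ρ N) k) ≤ 4 * (kinf ^ 2 + ρ * a) := by
    have hk2 : 0 ≤ kinf ^ 2 := sq_nonneg _
    refine max_le ?_ ?_ <;> nlinarith
  have hYle : C * (|t| / 2) ^ 2 * N / (kinf ^ 2 + ρ * a) ≤ C * t ^ 2 * N / max (ρ * a) (psq (sideLength ρ N) k) := by
    have hnum : 0 ≤ C * t ^ 2 * N := by positivity
    calc C * (|t| / 2) ^ 2 * N / (kinf ^ 2 + ρ * a)
        = C * t ^ 2 * N / (4 * (kinf ^ 2 + ρ * a)) := by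
          rw [div_pow, sq_abs]; field_simp; ring
      _ ≤ C * t ^ 2 * N / max (ρ * a) (psq (sideLength ρ N) k) :=
          div_le_div_of_nonneg_left hnum hmaxpos hmaxle
  have htI : -(|t| * |cosMean (sideLength ρ N) k Ψ|) ≤ t * cosMean (sideLength ρ N) k Ψ := by
    rw [← abs_mul]; exact neg_abs_le (t * _)
  unfold Ineq
  rw [hadef]
  linarith

/-- **Kernel certificate: `DensityResponse` ⟺ the infrared half of `StaticResponseBound`.**  The crux
stmt-AtomisticToContinuum-9481 BY NAME is equivalent to the registered infrared stub of the sibling crux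
stmt-AtomisticToContinuum-12057 (first hypothesis of `UvThomsonForceWave.staticResponseBound_of_halves`, verbatim). [folklore] -/
theorem densityResponse_iff_infraredHalf :
    BECThomsonPrinciple.DensityResponse ↔
    (∀ v : ℝ → ℝ≥0∞, IsRepulsiveFiniteRange v → ∀ M₀ : ℝ, 0 < M₀ →
      ∃ ρ₀ : ℝ, 0 < ρ₀ ∧ ∃ C : ℝ, 0 < C ∧
        ∀ ρ : ℝ, 0 < ρ → ρ < ρ₀ → ∀ N : ℕ, 0 < N → ∀ k : Fin 3 → ℤ, k ≠ 0 →
          psq (sideLength ρ N) k ≤ M₀ ^ 2 * (ρ * (scatteringLength v).toReal) →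
          ∀ t : ℝ, ∀ Ψ : PeriodicTrialState N (sideLength ρ N), periodicEnergy v Ψ ≠ ⊤ →
            Ineq v C ρ N k t Ψ) :=
  ⟨infraredHalf_of_densityResponse, densityResponse_of_infraredHalf⟩

end Summit.AtomisticToContinuum.BoseEinsteinCondensation.Cruxes.DensityResponse.InfraredEquiv

end
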